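import Literature.Analysis.FluidPDE.KNSSNoAxisymmetricTypeIHolds
import Summits.NavierStokesRegularity.NavierStokesRegularity.Theses.TypeIIInviscidRelaxation
import Summits.NavierStokesRegularity.NavierStokesRegularity.Theorems.AxisymmetricSwirlRegularity
import Literature.Analysis.FluidPDE.NSLerayHopfSereginEnergyProofs
import Literature.Analysis.FluidPDE.KatoFarFieldBound
import Literature.Analysis.FluidPDE.NSLerayExistenceR3Holds
import Literature.Analysis.FluidPDE.LerayLocalRegularH1Proofs
import Literature.Analysis.FluidPDE.RusinSverakLeraySolutions
import Literature.Analysis.FluidPDE.NSKatoToClayHolds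
import Literature.Analysis.FluidPDE.NSLerayHopf
import Literature.Analysis.FluidPDE.AxisymmetricNoSwirlGlobal
import Summits.NavierStokesRegularity.NavierStokesRegularity.Theorems.TypeICertificateLadderNoBlowupToClayLemmas
import HarnessLib

/-!
# Crux `AxisymSwirlRegular` (stmt-NavierStokesRegularity-1964, route `TypeIIInviscidRelaxation`):
# NO BLOW-UP IN THE STANDING AXISYMMETRIC CLASS ⇒ `AxisymmetricSwirlRegularity`

`--supports stmt-NavierStokesRegularity-1964` (helper; the generic half of every continuation-criterion
line on the axisymmetric-with-swirl hard core).

LANDED VERBATIM (modulo unfolding the one-line abbreviation `NoAxisymBlowup` into the hypothesis) from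
the cell memo nsreg-p3 ROUND-15 (`HOME/ns-regularity-ideate-p3/round-15/Law15.lean`,
`NsregP3.R15.axisymmetricSwirlRegularity_of_noBlowup`, planner-ns-regularity-ideate-p3 gen 10), replayed by
referee ns-regularity-ref3 (`SCORE-ROUND-15-p3.md`, standard axioms); landing requested by DIRECTOR-NS #46
(C249). Credit: nsreg-p3 (statement and proof); this seat only files it.

* `axisymmetricSwirlRegularity_of_noBlowup` — if every classical solution of the unforced Navier–Stokes
  system on `ℝ³ × [0,T)` (`ν, T > 0`) which is Leray–Hopf on `[0,T]` from its rapidly decaying datum,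
  bounded on every sub-slab `[0,T'] × ℝ³` (`T' < T`) and axisymmetric slice-wise (swirl allowed) extends
  smoothly past `T`, then `AxisymmetricSwirlRegularity` holds (global smooth solutions from smooth,
  divergence-free, rapidly decaying axisymmetric data). Proof (nsreg-p3): Kato maximal-time dichotomy; at
  a finite maximal time the classical representative patched from axisymmetric, slab-bounded Tao-class
  solutions and grafted with Leray's weak solution lies in the standing class, the hypothesis continues
  it past `T`, and the continuation is bounded near the singular point of the maximal Kato solution —
  contradiction.
* `axisymSwirlRegular_of_noBlowup` — the same with the ROUTE DECL
  `Theses.TypeIIInviscidRelaxation.AxisymSwirlRegular` (stmt-1964) as conclusion, by name (its inline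
  rotation clause is `IsAxisymmetric` by `Iff.rfl`).

WHAT THIS IS NOT: not a proof of 1964 — the no-blow-up hypothesis is the whole content (KNSS 2009
Thm 6.1 discharges it under a weighted-speed bound, tree `knss_no_axisymmetric_typeI_holds`). [folklore]
-/

noncomputable section

open Literature.Analysis.FluidPDE MeasureTheory Set Function Filter Topology Metric
open scoped ENNReal NNReal InnerProductSpace RealInnerProductSpace Laplacian

namespace Summit.NavierStokesRegularity.NavierStokesRegularity.Theorems

-- the problem directory repeats the summit name (`NavierStokesRegularity/NavierStokesRegularity`)
set_option linter.dupNamespace false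


/-- **No blow-up in the standing axisymmetric class ⇒ `AxisymmetricSwirlRegularity`.** The local
theory of `RadialInflowSplit.axisymSwirlRegular_of_radialInflow` (registered skeleton of
stmt-NavierStokesRegularity-1964) with the inflow hypothesis deleted: Kato maximal-time dichotomy;
at a finite maximal time the classical representative patched from axisymmetric, slab-bounded
Tao-class solutions and grafted with Leray's weak solution lies in the standing class, the
hypothesis continues it past `T`, and the continuation is bounded near the singular point of the
maximal Kato solution — contradiction. -/
theorem axisymmetricSwirlRegularity_of_noBlowup
    (hNB : ∀ (ν T : ℝ), 0 < ν → 0 < T →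
      ∀ (u : ℝ → EuclideanSpace ℝ (Fin 3) → EuclideanSpace ℝ (Fin 3))
        (p : ℝ → EuclideanSpace ℝ (Fin 3) → ℝ),
        IsClassicalNSSolutionOn (Set.Ico 0 T) ν 0 u p → IsLerayHopfOn T ν 0 (u 0) u →
        (∀ T' < T, ∃ M : ℝ, ∀ t ∈ Set.Icc 0 T', ∀ x, ‖u t x‖ ≤ M) →
        (∀ t ∈ Set.Ico 0 T, IsAxisymmetric (u t)) → HasRapidSpatialDecay (u 0) →
        HasSmoothExtensionPast ν 0 u T) :
    Summit.NavierStokesRegularity.NavierStokesRegularity.AxisymmetricSwirlRegularity := by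
  intro ν hν u₀ hsm hdiv hdec haxi
  classical
  /- ### the datum: axisymmetric, `H^∞`, `L²`, `L³`, weakly divergence free -/
  have hdivW : NSWave0.IsDivFree u₀ := fun x => hdiv x
  have hHk : ∀ n : ℕ, ∫⁻ x, ‖iteratedFDeriv ℝ n u₀ x‖ₑ ^ 2 < ⊤ :=
    hdec.lintegral_enorm_iteratedFDeriv_sq_lt_top
  have hmeas0 : AEStronglyMeasurable u₀ volume := hsm.continuous.aestronglyMeasurable
  have hL2 : ∫⁻ x, ‖u₀ x‖ₑ ^ 2 < ⊤ := by
    refine lt_of_le_of_lt (le_of_eq (lintegral_congr fun x => ?_)) (hHk 0)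
    rw [← ofReal_norm, ← ofReal_norm, norm_iteratedFDeriv_zero]
  have hu2 : MemLp u₀ 2 volume := ⟨hmeas0, eLpNorm_two_lt_top_of_lintegral_enorm_sq_lt_top hL2⟩
  obtain ⟨C₀, hC₀⟩ := hdec 0 0
  have hbd0 : ∀ x, ‖u₀ x‖ ≤ C₀ := fun x => by
    have h := hC₀ x
    rwa [pow_zero, one_mul, norm_iteratedFDeriv_zero] at h
  have hu3 : MemLp u₀ 3 volume := by
    refine ⟨hmeas0, ?_⟩
    have h3 : eLpNorm u₀ 3 volume ^ 3 ≤ eLpNorm u₀ ⊤ volume * eLpNorm u₀ 2 volume ^ 2 :=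
      eLpNorm_three_pow_le hmeas0
    have htop : eLpNorm u₀ ⊤ volume ≤ ENNReal.ofReal C₀ := eLpNorm_top_le_of_bound hbd0
    have hfin : eLpNorm u₀ ⊤ volume * eLpNorm u₀ 2 volume ^ 2 < ⊤ :=
      ENNReal.mul_lt_top (htop.trans_lt ENNReal.ofReal_lt_top)
        (ENNReal.pow_lt_top hu2.eLpNorm_lt_top)
    by_contra hnot
    rw [not_lt, top_le_iff] at hnot
    rw [hnot, ENNReal.top_pow (by norm_num)] at h3
    exact absurd (h3.trans_lt hfin) (lt_irrefl _)
  have hwdiv : IsWeaklyDivFree u₀ :=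
    VectorCalculus.IsDivFree.isWeaklyDivFree_holds hdiv (hsm.of_le (mod_cast le_top))
  /- ### the Kato maximal time -/
  by_cases htop : katoMaximalTime ν u₀ = ⊤
  · -- global Kato solution: the Clay solution, in classical form on `[0, ∞)`
    obtain ⟨u, p, hu, hp, hns, hE⟩ := clay_solution_of_hasGlobalKatoSolution_holds ν hν u₀ hsm hdivW
      hdec (hasGlobalKatoSolution_of_katoMaximalTime_eq_top kato_unique_holds hν htop)
    obtain ⟨hcl, h0⟩ := isNavierStokesSolution_and_smooth_iff.1 ⟨hns, hu, hp⟩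
    exact ⟨u, p, hcl, h0, hE⟩
  exfalso
  have hTm0 : 0 < katoMaximalTime ν u₀ := katoMaximalTime_pos kato_local_holds hν hu3 hwdiv
  have htop' : katoMaximalTime ν u₀ < ⊤ := lt_top_iff_ne_top.2 htop
  -- the maximal Kato solution `w` on `[0, T)`, `T = T_max`
  obtain ⟨w, hw⟩ := exists_isKatoSolutionOn_katoMaximalTime kato_unique_holds hν hTm0 htop'
  set T : ℝ := (katoMaximalTime ν u₀).toReal with hT_def
  have hT0 : 0 < T := ENNReal.toReal_pos hTm0.ne' htop'.ne
  have hofReal : ENNReal.ofReal T = katoMaximalTime ν u₀ := ENNReal.ofReal_toReal htop'.ne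
  have hmax : ∀ T'' : ℝ, T < T'' → ∀ w' : ℝ → EuclideanSpace ℝ (Fin 3) → EuclideanSpace ℝ (Fin 3),
      ¬ IsKatoSolutionOn T'' ν u₀ w' :=
    fun T'' hT'' w' => not_isKatoSolutionOn_of_katoMaximalTime_lt (by
      rw [← hofReal]
      exact (ENNReal.ofReal_lt_ofReal_iff (hT0.trans hT'')).2 hT'')
  -- its singular point `(T, x₁)`
  obtain ⟨x₁, hx₁⟩ := lemarieRieusset_singular_point_of_blowup_holds hν hT0 hu3 hwdiv hw hmax
  have hall : ∀ r : ℝ, 0 < r →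
      eLpNorm (uncurry w) ⊤ (volume.restrict (parabolicCylinder r ((T : ℝ), x₁))) = ⊤ :=
    fun r hr => eLpNorm_top_parabolicCylinder_eq_top_of_small hT0 hx₁ hr
  /- ### the classical representative on `[0, T)`: patched Tao-class solutions -/
  set Ts : ℕ → ℝ := fun n => T - T / ((n : ℝ) + 2) with hTs_def
  have hTs0 : ∀ n, 0 < Ts n := fun n => by
    have h1 : T / ((n : ℝ) + 2) < T := by
      rw [div_lt_iff₀ (by positivity)]
      nlinarith
    simp only [hTs_def]
    linarith
  have hTsT : ∀ n, Ts n < T := fun n => by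
    have h1 : 0 < T / ((n : ℝ) + 2) := by positivity
    simp only [hTs_def]
    linarith
  have hcof : ∀ t < T, ∃ n, t < Ts n := fun t ht => by
    obtain ⟨n, hn⟩ := exists_nat_gt (T / (T - t))
    refine ⟨n, ?_⟩
    have hpos : 0 < T - t := sub_pos.2 ht
    have h1 : T < ((n : ℝ) + 2) * (T - t) := by
      rw [div_lt_iff₀ hpos] at hn
      nlinarith
    have h2 : T / ((n : ℝ) + 2) < T - t := by
      rw [div_lt_iff₀ (by positivity)]
      linarith
    simp only [hTs_def]
    linarith
  have hex : ∀ n, ∃ (u : ℝ → EuclideanSpace ℝ (Fin 3) → EuclideanSpace ℝ (Fin 3))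
      (p : ℝ → EuclideanSpace ℝ (Fin 3) → ℝ), IsTaoSolutionOn (Ts n) ν u₀ u p :=
    fun n => exists_isTaoSolutionOn_of_isKatoSolutionOn hν hsm hdivW hdec hw (hTs0 n) (hTsT n)
  choose u p hup using hex
  obtain ⟨U, P, hcl, hU0, hUeq⟩ :=
    exists_classical_of_isTaoSolutionOn_family hν hTs0 (fun n => (hTsT n).le) hcof hup
  -- `U` agrees a.e. with the Kato solution `w` on every slice of `[0, T)`
  have hUw : ∀ t ∈ Ico 0 T, U t =ᵐ[volume] w t := by
    intro t ht
    obtain ⟨n, hn⟩ := hcof t ht.2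
    rw [(hUeq n t ⟨ht.1, hn⟩).1]
    have hwn : IsKatoSolutionOn (Ts n) ν u₀ w := hw.mono (hTsT n).le
    exact (hup n).ae_eq_of_kato hν hwn.mild hwn.continuousInLpOn hwn.aestronglyMeasurable
      t ⟨ht.1, hn⟩
  -- `U` is measurable on the strip
  have hUm : AEStronglyMeasurable (uncurry U) (volume.restrict (Ioo 0 T ×ˢ univ)) :=
    (hcl.smooth_velocity.continuousOn.mono
      (prod_mono Ioo_subset_Ico_self Subset.rfl)).aestronglyMeasurable
      (measurableSet_Ioo.prod MeasurableSet.univ)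
  -- `U` has AXISYMMETRIC slices on `[0, T)` (symmetry of the Tao-class patches)
  have hUax : ∀ t ∈ Ico 0 T, IsAxisymmetric (U t) := by
    intro t ht
    obtain ⟨n, hn⟩ := hcof t ht.2
    rw [(hUeq n t ⟨ht.1, hn⟩).1]
    exact (hup n).isAxisymmetric hν (hTs0 n) haxi t ⟨ht.1, hn.le⟩
  -- `U` is BOUNDED on every sub-slab `[0, T'] × ℝ³`, `T' < T` (bounds of the Tao-class patches)
  have hUbd : ∀ T' < T, ∃ M : ℝ, ∀ t ∈ Icc 0 T', ∀ x, ‖U t x‖ ≤ M := by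
    intro T' hT'
    obtain ⟨n, hn⟩ := hcof T' hT'
    obtain ⟨B, -, hB⟩ := (hup n).exists_bound_velocity
    refine ⟨B, fun t ht x => ?_⟩
    have htn : t < Ts n := ht.2.trans_lt hn
    rw [(hUeq n t ⟨ht.1, htn⟩).1]
    exact hB t ⟨ht.1, htn.le⟩ x
  /- ### Leray's weak solution, grafted at `T` -/
  obtain ⟨v, hv⟩ := leray_existence_R3_holds ν hν u₀ hu2 hwdiv
  -- `v(t) = U(t)` a.e. for `0 < t < T` (Prodi–Serrin, through the Tao-class solutions)
  have hvU : ∀ t ∈ Ioo 0 T, v t =ᵐ[volume] U t := by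
    intro t ht
    obtain ⟨n, hn⟩ := hcof t ht.2
    rw [(hUeq n t ⟨ht.1.le, hn⟩).1]
    have hLH : IsLerayHopfOn (Ts n) ν 0 u₀ (u n) := (hup n).isLerayHopfOn (hTs0 n)
    obtain ⟨B, -, hB⟩ := (hup n).exists_bound_velocity
    have hSer : MemLqLp ⊤ ⊤ (u n) (Ioo 0 (Ts n)) :=
      memLqLp_top_top_of_bound (fun s hs => (hup n).aestronglyMeasurable_slice hs) hB
    exact weak_strong_uniqueness_holds hν (hTs0 n) hLH (q := ⊤) (r := ⊤) ENNReal.ofNat_lt_top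
      (by simp [ENNReal.div_top]) hSer (hv.isLerayHopfOn (hTs0 n)) t ⟨ht.1, hn.le⟩
  -- reset the unconstrained slice `v 0`
  set v' : ℝ → EuclideanSpace ℝ (Fin 3) → EuclideanSpace ℝ (Fin 3) :=
    fun t => if t = 0 then u₀ else v t with hv'_def
  have hLHv' : IsLerayHopfOn T ν 0 u₀ v' :=
    isLerayHopfOn_update_initial (hv.isLerayHopfOn hT0) hu2
  -- the grafted field
  set V : ℝ → EuclideanSpace ℝ (Fin 3) → EuclideanSpace ℝ (Fin 3) :=
    fun t => if t < T then U t else v t with hV_def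
  have hVlt : ∀ {t : ℝ}, t < T → V t = U t := fun {t} ht => by simp only [hV_def, if_pos ht]
  have hV0 : V 0 = u₀ := by rw [hVlt hT0, hU0]
  have hVm : AEStronglyMeasurable (uncurry V) (volume.restrict (Ioo 0 T ×ˢ univ)) := by
    refine hUm.congr ?_
    filter_upwards [ae_restrict_mem (measurableSet_Ioo.prod MeasurableSet.univ)] with z hz
    obtain ⟨t, x⟩ := z
    simp only [uncurry_apply_pair, hVlt (show t < T from hz.1.2)]
  have hVeq : ∀ t ∈ Icc 0 T, V t =ᵐ[volume] v' t := by
    intro t ht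
    rcases eq_or_lt_of_le ht.1 with h0 | hpos
    · subst h0
      rw [hV0]
      simp [hv'_def]
    have hv't : v' t = v t := by simp only [hv'_def, if_neg hpos.ne']
    rw [hv't]
    rcases lt_or_eq_of_le ht.2 with hlt | heq
    · rw [hVlt hlt]
      exact (hvU t ⟨hpos, hlt⟩).symm
    · subst heq
      simp only [hV_def, lt_irrefl, if_false]
      exact Filter.EventuallyEq.rfl
  have hLHV : IsLerayHopfOn T ν 0 u₀ V := hLHv'.congr_ae_slices hT0 hVm hVeq
  have hclV : IsClassicalNSSolutionOn (Ico 0 T) ν 0 V P :=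
    hcl.congr_slices (fun t ht => hVlt ht.2) fun t _ => rfl
  /- ### the standing class at the maximal time -/
  have hLHV' : IsLerayHopfOn T ν 0 (V 0) V := by
    rw [hV0]
    exact hLHV
  have hdecV : HasRapidSpatialDecay (V 0) := by
    rw [hV0]
    exact hdec
  have haxV : ∀ t ∈ Ico 0 T, IsAxisymmetric (V t) := fun t ht => by
    rw [hVlt ht.2]
    exact hUax t ht
  have hbdV : ∀ T' < T, ∃ M : ℝ, ∀ t ∈ Icc 0 T', ∀ x, ‖V t x‖ ≤ M := by
    intro T' hT'
    obtain ⟨M, hM⟩ := hUbd T' hT'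
    refine ⟨M, fun t ht x => ?_⟩
    rw [hVlt (ht.2.trans_lt hT')]
    exact hM t ht x
  /- ### the two pieces: a-priori inflow bound (`X₂`), then the inflow criterion (`X₁`) -/
  obtain ⟨T', hTT', u', p', hcl', hagree⟩ := hNB ν T hν hT0 V P hclV hLHV' hbdV haxV hdecV
  -- the continuation is bounded on the compact `[T/2, T] × B̄(x₁, 1)`
  set K : Set (ℝ × EuclideanSpace ℝ (Fin 3)) := Icc (T / 2) T ×ˢ closedBall x₁ 1 with hK_def
  have hK : IsCompact K := isCompact_Icc.prod (isCompact_closedBall _ _)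
  have hKsub : K ⊆ Ico 0 T' ×ˢ (univ : Set (EuclideanSpace ℝ (Fin 3))) :=
    prod_mono (fun t ht => ⟨by linarith [ht.1], ht.2.trans_lt hTT'⟩) (subset_univ _)
  have hcont : ContinuousOn (uncurry u') K := hcl'.smooth_velocity.continuousOn.mono hKsub
  obtain ⟨M, hM⟩ := hK.exists_bound_of_continuousOn hcont
  -- a small cylinder `Q_r(T, x₁) ⊆ K`, `r ≤ 1`, `r² ≤ T/2`
  set r : ℝ := min 1 (Real.sqrt (T / 2)) with hr_def
  have hr0 : 0 < r := lt_min one_pos (Real.sqrt_pos.2 (by positivity))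
  have hr1 : r ≤ 1 := min_le_left _ _
  have hr2 : r ^ 2 ≤ T / 2 := by
    calc r ^ 2 ≤ Real.sqrt (T / 2) ^ 2 := pow_le_pow_left₀ hr0.le (min_le_right _ _) 2
      _ = T / 2 := Real.sq_sqrt (by positivity)
  have hcylK : parabolicCylinder r ((T : ℝ), x₁) ⊆ K := by
    rintro ⟨s, y⟩ hz
    rw [mem_parabolicCylinder] at hz
    exact ⟨⟨by linarith [hz.1.1], hz.1.2.le⟩, mem_closedBall.2 (hz.2.le.trans hr1)⟩
  -- on the cylinder `U = u'`, so `U` is essentially bounded there …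
  have hbdU : eLpNorm (uncurry U) ⊤ (volume.restrict (parabolicCylinder r ((T : ℝ), x₁))) < ⊤ := by
    rw [eLpNorm_exponent_top]
    refine eLpNormEssSup_lt_top_of_ae_bound (C := M) ?_
    filter_upwards [ae_restrict_mem (isOpen_parabolicCylinder r ((T : ℝ), x₁)).measurableSet]
      with z hz
    have hzK := hcylK hz
    obtain ⟨s, y⟩ := z
    rw [mem_parabolicCylinder] at hz
    have hs : s ∈ Ico 0 T := ⟨by linarith [hz.1.1, hr2], hz.1.2⟩
    have heq : uncurry U (s, y) = uncurry u' (s, y) := by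
      simp only [uncurry_apply_pair, hagree s hs, hVlt hs.2]
    rw [heq]
    exact hM _ hzK
  -- … while the singularity of `w` at `(T, x₁)` transfers to `U`
  have hUw' : uncurry U =ᵐ[volume.restrict (Ioo 0 T ×ˢ (univ : Set (EuclideanSpace ℝ (Fin 3))))]
      uncurry w :=
    ae_restrict_prod_of_forall_ae_eq (fun t ht => hUw t ⟨ht.1.le, ht.2⟩) hUm
      hw.aestronglyMeasurable
  exact hbdU.ne (eLpNorm_parabolicCylinder_eq_top_of_ae_eq hT0 hUw' x₁ hall hr0)


/-- **No blow-up in the standing axisymmetric class ⇒ `AxisymSwirlRegular`** (hard core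
stmt-NavierStokesRegularity-1964, the route decl of `Theses/TypeIIInviscidRelaxation.lean` BY NAME; its
inline rotation clause is `IsAxisymmetric` by `Iff.rfl`). (nsreg-p3 ROUND-15.) [folklore] -/
theorem axisymSwirlRegular_of_noBlowup
    (hNB : ∀ (ν T : ℝ), 0 < ν → 0 < T →
      ∀ (u : ℝ → EuclideanSpace ℝ (Fin 3) → EuclideanSpace ℝ (Fin 3))
        (p : ℝ → EuclideanSpace ℝ (Fin 3) → ℝ),
        IsClassicalNSSolutionOn (Set.Ico 0 T) ν 0 u p → IsLerayHopfOn T ν 0 (u 0) u →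
        (∀ T' < T, ∃ M : ℝ, ∀ t ∈ Set.Icc 0 T', ∀ x, ‖u t x‖ ≤ M) →
        (∀ t ∈ Set.Ico 0 T, IsAxisymmetric (u t)) → HasRapidSpatialDecay (u 0) →
        HasSmoothExtensionPast ν 0 u T) :
    Summit.NavierStokesRegularity.NavierStokesRegularity.Theses.TypeIIInviscidRelaxation.AxisymSwirlRegular :=
  fun ν hν u₀ hsm hdiv hdec hax =>
    axisymmetricSwirlRegularity_of_noBlowup hNB ν hν u₀ hsm hdiv hdec (fun θ x => hax θ x)

end Summit.NavierStokesRegularity.NavierStokesRegularity.Theorems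

end
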